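import Summits.Ventures.CertifiedManyBodySolver.Upper.StripCellRowSum
import HarnessLib

/-!
# Route `R2cOpenStripTangentLine`, writer (ii) add-on 4/4 (route pen sr-mbsolver-var-7): the DART COUNT of the open box, the
PRODUCER-FREE LOEWNER BOUND `γ₀·1 ∓ hh ⪰ 0` (`γ₀ = 4((c−1)W + c(W−1)) + 4W + 8cW` at `(t, U) = (1, 8)`, `240` for `c = W = 4`;
Geršgorin on the Hermitian `hh`), and the CONSUMERS through hubbard-r2c-p1's `m3Upper_tp0_le_m18o25_of_stripCell_umps_dual[_dyadic]`:
`…_dual_sectors` (exact tensor, per-sector PSD blocks), `…_dual_dyadic_structural` (the dyadic consumer with `hγ hX₁ hX₂`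
DISCHARGED), `…_dual_dyadic_sectors`, `…_dual_dyadic_structural_sectors` (the by-value entry point for a `bd-strip-cell-v1`
certificate), `…_of_exists_stripCellCert` (claim-node packaging) — all `proof.conditional` by design

HONEST FRAMING: first certified bounds; not a superconductivity verdict; every number certified or labelled float.
NO NUMBER IS CLAIMED HERE. No certificate `≤ −18/25` per site at density `7/8` exists today — the route's cruxes stay OPEN.

Dictionary to the certificate's fields: route pen `WRITER-II-SPEC.md` §2b. Sources: VAR `METHOD-umps.md` §2–§3; Horn–Johnson (2013)
Thm. 6.1.1 [HornJohnson2013]; Ruelle (1969) §3.4 [Ruelle1969].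
-/

noncomputable section

open Matrix Finset
open scoped ComplexOrder BigOperators Kronecker

namespace Summit.Ventures.CertifiedManyBodySolver.Theorems

open Literature.MathematicalPhysics.QuantumLattice
open Literature.MathematicalPhysics.QuantumLattice.JordanWigner
open Literature.LinearAlgebra.Matrix.PolarOrthonormalization
open Summit.Ventures.CertifiedManyBodySolver.Upper

/-! ### Part R — the dart count of the open box (closed form of the row-sum constant) -/

section DartCount

/-- On `Fin n`, the number of ordered pairs `(i, i')` with `i + 1 = i'` is `n - 1`. [folklore] -/
theorem sum_sum_ite_succ_eq (n : ℕ) :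
    (∑ i : Fin n, ∑ i' : Fin n, if (i : ℕ) + 1 = i' then (1 : ℕ) else 0) = n - 1 := by
  have inner : ∀ i : Fin n, (∑ i' : Fin n, if (i : ℕ) + 1 = i' then (1 : ℕ) else 0) =
      if (i : ℕ) + 1 < n then 1 else 0 := by
    intro i
    split_ifs with h
    · rw [Finset.sum_eq_single (⟨(i : ℕ) + 1, h⟩ : Fin n)]
      · simp
      · intro i' _ hne
        rw [if_neg]
        intro he
        exact hne (Fin.ext he.symm)
      · intro hh
        exact absurd (Finset.mem_univ _) hh
    · refine Finset.sum_eq_zero fun i' _ => ?_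
      rw [if_neg]
      intro he
      exact h (he ▸ i'.isLt)
  simp_rw [inner]
  rw [Finset.sum_boole]
  rcases Nat.eq_zero_or_pos n with rfl | hn
  · simp
  · have hset : (Finset.univ.filter fun i : Fin n => (i : ℕ) + 1 < n) = Finset.Iio ⟨n - 1, by omega⟩ := by
      ext i
      simp only [Finset.mem_filter, Finset.mem_univ, true_and, Finset.mem_Iio, Fin.lt_def]
      omega
    rw [hset, Fin.card_Iio]
    simp

/-- On `Fin n`, the number of ordered chain-adjacent pairs is `2 (n - 1)`. [folklore] -/
theorem sum_sum_ite_lineAdj (n : ℕ) :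
    (∑ i : Fin n, ∑ i' : Fin n, if lineAdj i i' then (1 : ℕ) else 0) = 2 * (n - 1) := by
  have hsplit : ∀ i i' : Fin n, (if lineAdj i i' then (1 : ℕ) else 0) =
      (if (i : ℕ) + 1 = i' then 1 else 0) + (if (i' : ℕ) + 1 = i then 1 else 0) := by
    intro i i'
    unfold lineAdj
    by_cases h1 : (i : ℕ) + 1 = i' <;> by_cases h2 : (i' : ℕ) + 1 = i
    · omega
    · simp [h1, h2]
    · simp [h1, h2]
    · simp [h1, h2]
  simp_rw [hsplit, Finset.sum_add_distrib]
  rw [sum_sum_ite_succ_eq n]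
  rw [Finset.sum_comm, sum_sum_ite_succ_eq n]
  ring

/-- **The dart count of the open `c × W` box**: `#{(f, f') : f ∼ f'} = 2((c-1)W + c(W-1))`. [folklore] -/
theorem sum_sum_ite_rectBoxGraph_adj (c W : ℕ) :
    (∑ f : Fin c ×ₗ Fin W, ∑ f' : Fin c ×ₗ Fin W, if (rectBoxGraph c W).Adj f f' then (1 : ℕ) else 0) =
      2 * ((c - 1) * W + c * (W - 1)) := by
  -- pass from `Lex` to the product
  have hLex : (∑ f : Fin c ×ₗ Fin W, ∑ f' : Fin c ×ₗ Fin W, if (rectBoxGraph c W).Adj f f' then (1 : ℕ) else 0) =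
      ∑ x : Fin c × Fin W, ∑ x' : Fin c × Fin W,
        if (rectBoxGraph c W).Adj (toLex x) (toLex x') then (1 : ℕ) else 0 := by
    rw [← (toLex : Fin c × Fin W ≃ Fin c ×ₗ Fin W).sum_comp]
    refine Finset.sum_congr rfl fun x _ => ?_
    rw [← (toLex : Fin c × Fin W ≃ Fin c ×ₗ Fin W).sum_comp]
  rw [hLex]
  -- the adjacency indicator is the sum of the two (exclusive) disjuncts
  have hsplit : ∀ x x' : Fin c × Fin W,
      (if (rectBoxGraph c W).Adj (toLex x) (toLex x') then (1 : ℕ) else 0) =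
        (if x.2 = x'.2 then 1 else 0) * (if lineAdj x.1 x'.1 then 1 else 0) +
          (if x.1 = x'.1 then 1 else 0) * (if lineAdj x.2 x'.2 then 1 else 0) := by
    intro x x'
    have hadj : (rectBoxGraph c W).Adj (toLex x) (toLex x') ↔
        (x.2 = x'.2 ∧ lineAdj x.1 x'.1) ∨ (x.1 = x'.1 ∧ lineAdj x.2 x'.2) := Iff.rfl
    rw [ite_zero_mul_ite_zero, ite_zero_mul_ite_zero, mul_one]
    by_cases hA : x.2 = x'.2 ∧ lineAdj x.1 x'.1 <;> by_cases hB : x.1 = x'.1 ∧ lineAdj x.2 x'.2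
    · exfalso
      obtain ⟨-, h1⟩ := hA
      obtain ⟨h2, -⟩ := hB
      unfold lineAdj at h1
      rw [h2] at h1
      omega
    · rw [if_pos (hadj.mpr (Or.inl hA)), if_pos hA, if_neg hB, add_zero]
    · rw [if_pos (hadj.mpr (Or.inr hB)), if_neg hA, if_pos hB, zero_add]
    · rw [if_neg (fun hh => (hadj.mp hh).elim hA hB), if_neg hA, if_neg hB, add_zero]
  simp_rw [hsplit, Finset.sum_add_distrib]
  simp_rw [Fintype.sum_prod_type]
  -- first block: Σ_i Σ_j Σ_i' Σ_j' [j = j'] [lineAdj i i'] = 2 (c - 1) · W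
  have h1 : (∑ i : Fin c, ∑ j : Fin W, ∑ i' : Fin c, ∑ j' : Fin W,
      (if j = j' then 1 else 0) * (if lineAdj i i' then (1 : ℕ) else 0)) = 2 * (c - 1) * W := by
    have : ∀ (i : Fin c) (j : Fin W) (i' : Fin c), (∑ j' : Fin W,
        (if j = j' then 1 else 0) * (if lineAdj i i' then (1 : ℕ) else 0)) =
        if lineAdj i i' then 1 else 0 := by
      intro i j i'
      rw [← Finset.sum_mul, Finset.sum_ite_eq]
      simp
    simp_rw [this]
    rw [show (∑ i : Fin c, ∑ _j : Fin W, ∑ i' : Fin c, if lineAdj i i' then (1 : ℕ) else 0) =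
        ∑ i : Fin c, (W * ∑ i' : Fin c, if lineAdj i i' then (1 : ℕ) else 0) from
      Finset.sum_congr rfl fun i _ => by simp]
    rw [← Finset.mul_sum, sum_sum_ite_lineAdj]
    ring
  -- second block: Σ_i Σ_j Σ_i' Σ_j' [i = i'] [lineAdj j j'] = c · 2 (W - 1)
  have h2 : (∑ i : Fin c, ∑ j : Fin W, ∑ i' : Fin c, ∑ j' : Fin W,
      (if i = i' then 1 else 0) * (if lineAdj j j' then (1 : ℕ) else 0)) = c * (2 * (W - 1)) := by
    have : ∀ (i : Fin c) (j : Fin W), (∑ i' : Fin c, ∑ j' : Fin W,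
        (if i = i' then 1 else 0) * (if lineAdj j j' then (1 : ℕ) else 0)) =
        ∑ j' : Fin W, if lineAdj j j' then 1 else 0 := by
      intro i j
      rw [Finset.sum_comm]
      refine Finset.sum_congr rfl fun j' _ => ?_
      rw [← Finset.sum_mul, Finset.sum_ite_eq]
      simp
    simp_rw [this]
    simp_rw [sum_sum_ite_lineAdj]
    simp
  rw [h1, h2]
  rcases Nat.eq_zero_or_pos c with rfl | hc
  · simp
  rcases Nat.eq_zero_or_pos W with rfl | hW
  · simp
  obtain ⟨c', rfl⟩ := Nat.exists_eq_add_of_le hc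
  obtain ⟨W', rfl⟩ := Nat.exists_eq_add_of_le hW
  simp only [Nat.add_sub_cancel_left]
  ring

end DartCount

/-! ### Part R — the Loewner bound of the cell bond matrix (Geršgorin) -/

section Loewner

variable {c W Q : ℕ}


/-- **Closed form of the row-sum constant**: `|t|·(4((c−1)W + c(W−1)) + 4W) + |U|·cW` (natural-number
subtraction inside the cast; at `(t, U) = (1, 8)`, `c = W = 4` this is `240`). [folklore] -/
theorem stripCellRowBound_eq (c W : ℕ) (t U : ℝ) :
    stripCellRowBound c W t U =
      |t| * (4 * (((c - 1) * W + c * (W - 1) : ℕ) : ℝ) + 4 * W) + |U| * (c * W) := by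
  have h2 : (∑ f : Fin c ×ₗ Fin W, ∑ f' : Fin c ×ₗ Fin W, if (rectBoxGraph c W).Adj f f' then (2 : ℝ) else 0) =
      2 * ((∑ f : Fin c ×ₗ Fin W, ∑ f' : Fin c ×ₗ Fin W,
        if (rectBoxGraph c W).Adj f f' then (1 : ℕ) else 0 : ℕ) : ℝ) := by
    push_cast
    rw [Finset.mul_sum]
    refine Finset.sum_congr rfl fun f _ => ?_
    rw [Finset.mul_sum]
    refine Finset.sum_congr rfl fun f' _ => ?_
    split_ifs <;> norm_num
  unfold stripCellRowBound
  rw [h2, sum_sum_ite_rectBoxGraph_adj]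
  push_cast
  ring

/-- **PRODUCER-FREE LOEWNER BOUND of the strip cell bond matrix** (Geršgorin on a Hermitian matrix with row sums
`≤ γ`): `γ·1 − hh ⪰ 0` and `γ·1 + hh ⪰ 0` for every `γ ≥ stripCellRowBound c W t U`. These are exactly the inputs
`hX₁`, `hX₂` of `m3Upper_tp0_le_m18o25_of_stripCell_umps_dual_dyadic`. [cite: HornJohnson2013, Thm. 6.1.1] -/
theorem stripCellBondMatrix_loewner (κ : TensorIndex (Fin c ×ₗ Fin W) 4 ≃ Fin Q) (hc : 0 < c) (t U : ℝ)
    {γ : ℝ} (hγ : stripCellRowBound c W t U ≤ γ) :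
    (((γ : ℂ)) • (1 : Matrix (Fin Q × Fin Q) (Fin Q × Fin Q) ℂ) - stripCellBondMatrix κ hc t U).PosSemidef ∧
      (((γ : ℂ)) • (1 : Matrix (Fin Q × Fin Q) (Fin Q × Fin Q) ℂ) + stripCellBondMatrix κ hc t U).PosSemidef := by
  have hX : ∀ p, ∑ p', ‖stripCellBondMatrix κ hc t U p p'‖ ≤ γ :=
    fun p => (stripCellBondMatrix_rowSum_le κ hc t U p).trans hγ
  have hXh := stripCellBondMatrix_isHermitian κ hc t U
  refine ⟨Matrix.le_iff.mp (le_smul_one_of_rowSum_le hXh hX), ?_⟩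
  have h := Matrix.le_iff.mp (neg_smul_one_le_of_rowSum_le hXh hX)
  rwa [sub_neg_eq_add, add_comm] at h

/-- By-value sanity (c = W = 4, (t, U) = (1, 8)): the constant is `240` = eng-1's `norm_intra + norm_inter`. -/
example : stripCellRowBound 4 4 1 8 = 240 := by
  rw [stripCellRowBound_eq]; norm_num

end Loewner

/-! ### Part D — consumers (through hubbard-r2c-p1's consumers of record) -/

section Consumers

variable {c W Q D : ℕ}

/-- **Exact tensor, PER-SECTOR certificates.** As `m3Upper_tp0_le_m18o25_of_stripCell_umps_dual` (r2c-p1) with the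
dense hypothesis `cc·1 − W(A;X,Z) ⪰ 0` replaced by one positive semidefinite principal block per occurring cut label
`q` (blocks presented by injective `emb q : Fin (m q) → Fin D` covering the label class — the producer's sector
enumeration), for a label-block-diagonal dual `Z`; charge conservation of the strip bond matrix is discharged by
`stripCellBondMatrix_conservesCharge`. -/
theorem m3Upper_tp0_le_m18o25_of_stripCell_umps_dual_sectors (W c : ℕ) (hW : 1 ≤ W) (hc : 0 < c)
    (κ : TensorIndex (Fin c ×ₗ Fin W) 4 ≃ Fin Q) (A : MPSTensor Q D) (hA : ∑ S, (A S)ᴴ * A S = 1)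
    (r : Fin D → ℂ) (hr : star r ⬝ᵥ r = 1) (Z : Matrix (Fin D) (Fin D) ℂ) (cc z : ℚ)
    (hZ₁ : ((((z : ℚ) : ℝ) : ℂ) • (1 : Matrix (Fin D) (Fin D) ℂ) - Z).PosSemidef)
    (hZ₂ : ((((z : ℚ) : ℝ) : ℂ) • (1 : Matrix (Fin D) (Fin D) ℂ) + Z).PosSemidef)
    (lab : Fin D → ℤ) (Qc qmin qmax : ℤ)
    (hBC : ∀ (S : Fin Q) (α β : Fin D), A S α β ≠ 0 → lab β + Qc = lab α + cellCharge κ S)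
    (hlab : ∀ α, qmin ≤ lab α ∧ lab α ≤ qmax) (hQc : (8 : ℤ) * Qc = 7 * ((W : ℤ) * (c : ℤ)))
    (hZb : ∀ α β, Z α β ≠ 0 → lab α = lab β)
    {m : ℤ → ℕ} (emb : ∀ q, Fin (m q) → Fin D) (hinj : ∀ q, Function.Injective (emb q))
    (hcover : ∀ α, ∃ i, emb (lab α) i = α)
    (hpsd : ∀ q ∈ Finset.univ.image lab,
      ((((((cc : ℚ) : ℝ) : ℂ)) • (1 : Matrix (Fin D) (Fin D) ℂ) -
          dualMatrix A (stripCellBondMatrix κ hc 1 8) Z).submatrix (emb q) (emb q)).PosSemidef)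
    (hbar : cc / ((W : ℚ) * (c : ℚ)) ≤ -18 / 25) :
    Summit.Ventures.CertifiedManyBodySolver.MbsolverRungLeaves.M3Upper_tp0_le_m18o25 :=
  m3Upper_tp0_le_m18o25_of_stripCell_umps_dual W c hW hc κ A hA r hr Z cc z
    (posSemidef_sub_dualMatrix_of_sectors A lab Qc (cellCharge κ) hBC (stripCellBondMatrix κ hc 1 8)
      (stripCellBondMatrix_conservesCharge κ hc 1 8) Z hZb _ emb hinj hcover hpsd)
    hZ₁ hZ₂ lab Qc qmin qmax hBC hlab hQc hbar

/-- **STORED (dyadic) tensor, dense certificate, PRODUCER-FREE bond-matrix bound**: r2c-p1's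
`m3Upper_tp0_le_m18o25_of_stripCell_umps_dual_dyadic` with its inputs `hγ`, `hX₁`, `hX₂` DISCHARGED by
`stripCellBondMatrix_loewner` at `γ := stripCellRowBound c W 1 8`. Readers' remaining inputs: the Gram defect `ε`,
`r`, `Z` with `z·1 ∓ Z ⪰ 0`, the slack `η ≥ (1 + 1/(1−ε))·(ε/(1−ε))·(1+ε)·(γ₀(2+ε) + z)`, the certificate
`(c_cert − η)·1 − W(A; hh, Z) ⪰ 0`, the block rule / window / `8·Q_c = 7·W·c`, the bar. [cite: Ruelle1969, §3.4] -/
theorem m3Upper_tp0_le_m18o25_of_stripCell_umps_dual_dyadic_structural (W c : ℕ) (hW : 1 ≤ W) (hc : 0 < c)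
    (κ : TensorIndex (Fin c ×ₗ Fin W) 4 ≃ Fin Q) (A : MPSTensor Q D) {ε η : ℝ} (hε0 : 0 ≤ ε) (hε1 : ε < 1)
    (hG : ∀ i, ∑ j, ‖(Upper.gram A - 1) i j‖ ≤ ε)
    (r : Fin D → ℂ) (hr : star r ⬝ᵥ r = 1) (Z : Matrix (Fin D) (Fin D) ℂ) (cc z : ℚ) (hz : 0 ≤ z)
    (hZ₁ : ((((z : ℚ) : ℝ) : ℂ) • (1 : Matrix (Fin D) (Fin D) ℂ) - Z).PosSemidef)
    (hZ₂ : ((((z : ℚ) : ℝ) : ℂ) • (1 : Matrix (Fin D) (Fin D) ℂ) + Z).PosSemidef)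
    (hη : (1 + 1 / (1 - ε)) * (ε / (1 - ε)) * (1 + ε) *
      ((4 * (((c - 1) * W + c * (W - 1) : ℕ) : ℝ) + 4 * W + 8 * (c * W)) * (1 + (1 + ε)) + ((z : ℚ) : ℝ)) ≤ η)
    (hdual : (((((cc : ℚ) : ℝ) - η : ℝ) : ℂ) • (1 : Matrix (Fin D) (Fin D) ℂ) -
      dualMatrix A (stripCellBondMatrix κ hc 1 8) Z).PosSemidef)
    (lab : Fin D → ℤ) (Qc qmin qmax : ℤ)
    (hBC : ∀ (S : Fin Q) (α β : Fin D), A S α β ≠ 0 → lab β + Qc = lab α + cellCharge κ S)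
    (hlab : ∀ α, qmin ≤ lab α ∧ lab α ≤ qmax) (hQc : (8 : ℤ) * Qc = 7 * ((W : ℤ) * (c : ℤ)))
    (hbar : cc / ((W : ℚ) * (c : ℚ)) ≤ -18 / 25) :
    Summit.Ventures.CertifiedManyBodySolver.MbsolverRungLeaves.M3Upper_tp0_le_m18o25 := by
  have hγ : stripCellRowBound c W 1 8 = 4 * (((c - 1) * W + c * (W - 1) : ℕ) : ℝ) + 4 * W + 8 * (c * W) := by
    rw [stripCellRowBound_eq]; norm_num
  have hγ0 : (0 : ℝ) ≤ 4 * (((c - 1) * W + c * (W - 1) : ℕ) : ℝ) + 4 * W + 8 * (c * W) := by positivity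
  obtain ⟨hX₁, hX₂⟩ := stripCellBondMatrix_loewner κ hc 1 8 hγ.le
  exact m3Upper_tp0_le_m18o25_of_stripCell_umps_dual_dyadic W c hW hc κ A hε0 hε1
    hγ0 hG hX₁ hX₂ r hr Z cc z hz hZ₁ hZ₂ hη hdual lab Qc qmin qmax hBC hlab hQc hbar

/-- **STORED (dyadic) tensor, PER-SECTOR certificate** (the shape `bd-strip-cell-v1` emits): r2c-p1's dyadic
consumer with the dense `(c_cert − η)·1 − W(A) ⪰ 0` replaced by one PSD block per cut label (`emb q` lists the
label-`q` indices injectively and exhaustively; `Z` label-diagonal); block-diagonality of the dual is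
`posSemidef_sub_dualMatrix_of_sectors` with `stripCellBondMatrix_conservesCharge`. [cite: Ruelle1969, §3.4] -/
theorem m3Upper_tp0_le_m18o25_of_stripCell_umps_dual_dyadic_sectors (W c : ℕ) (hW : 1 ≤ W) (hc : 0 < c)
    (κ : TensorIndex (Fin c ×ₗ Fin W) 4 ≃ Fin Q) (A : MPSTensor Q D) {ε γ η : ℝ} (hε0 : 0 ≤ ε) (hε1 : ε < 1)
    (hγ : 0 ≤ γ) (hG : ∀ i, ∑ j, ‖(Upper.gram A - 1) i j‖ ≤ ε)
    (hX₁ : ((γ : ℂ) • (1 : Matrix (Fin Q × Fin Q) (Fin Q × Fin Q) ℂ) - stripCellBondMatrix κ hc 1 8).PosSemidef)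
    (hX₂ : ((γ : ℂ) • (1 : Matrix (Fin Q × Fin Q) (Fin Q × Fin Q) ℂ) + stripCellBondMatrix κ hc 1 8).PosSemidef)
    (r : Fin D → ℂ) (hr : star r ⬝ᵥ r = 1) (Z : Matrix (Fin D) (Fin D) ℂ) (cc z : ℚ) (hz : 0 ≤ z)
    (hZ₁ : ((((z : ℚ) : ℝ) : ℂ) • (1 : Matrix (Fin D) (Fin D) ℂ) - Z).PosSemidef)
    (hZ₂ : ((((z : ℚ) : ℝ) : ℂ) • (1 : Matrix (Fin D) (Fin D) ℂ) + Z).PosSemidef)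
    (hη : (1 + 1 / (1 - ε)) * (ε / (1 - ε)) * (1 + ε) * (γ * (1 + (1 + ε)) + ((z : ℚ) : ℝ)) ≤ η)
    (lab : Fin D → ℤ) (Qc qmin qmax : ℤ)
    (hBC : ∀ (S : Fin Q) (α β : Fin D), A S α β ≠ 0 → lab β + Qc = lab α + cellCharge κ S)
    (hlab : ∀ α, qmin ≤ lab α ∧ lab α ≤ qmax) (hQc : (8 : ℤ) * Qc = 7 * ((W : ℤ) * (c : ℤ)))
    (hZb : ∀ α β, Z α β ≠ 0 → lab α = lab β)
    {m : ℤ → ℕ} (emb : ∀ q, Fin (m q) → Fin D) (hinj : ∀ q, Function.Injective (emb q))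
    (hcover : ∀ α, ∃ i, emb (lab α) i = α)
    (hpsd : ∀ q ∈ Finset.univ.image lab,
      (((((((cc : ℚ) : ℝ) - η : ℝ) : ℂ)) • (1 : Matrix (Fin D) (Fin D) ℂ) -
          dualMatrix A (stripCellBondMatrix κ hc 1 8) Z).submatrix (emb q) (emb q)).PosSemidef)
    (hbar : cc / ((W : ℚ) * (c : ℚ)) ≤ -18 / 25) :
    Summit.Ventures.CertifiedManyBodySolver.MbsolverRungLeaves.M3Upper_tp0_le_m18o25 :=
  m3Upper_tp0_le_m18o25_of_stripCell_umps_dual_dyadic W c hW hc κ A hε0 hε1 hγ hG hX₁ hX₂ r hr Z cc z hz hZ₁ hZ₂ hη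
    (posSemidef_sub_dualMatrix_of_sectors A lab Qc (cellCharge κ) hBC (stripCellBondMatrix κ hc 1 8)
      (stripCellBondMatrix_conservesCharge κ hc 1 8) Z hZb _ emb hinj hcover hpsd)
    lab Qc qmin qmax hBC hlab hQc hbar

/-- **STORED (dyadic) tensor, PER-SECTOR certificate, PRODUCER-FREE bond-matrix bound** — the by-value entry point
for a `bd-strip-cell-v1` certificate: `…_dyadic_sectors` with `hγ hX₁ hX₂` discharged (`γ := 4((c−1)W + c(W−1)) + 4W + 8cW`, the closed form of `stripCellRowBound c W 1 8`; `240` for `c = W = 4`).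
[cite: Ruelle1969, §3.4] -/
theorem m3Upper_tp0_le_m18o25_of_stripCell_umps_dual_dyadic_structural_sectors (W c : ℕ) (hW : 1 ≤ W)
    (hc : 0 < c) (κ : TensorIndex (Fin c ×ₗ Fin W) 4 ≃ Fin Q) (A : MPSTensor Q D) {ε η : ℝ} (hε0 : 0 ≤ ε)
    (hε1 : ε < 1) (hG : ∀ i, ∑ j, ‖(Upper.gram A - 1) i j‖ ≤ ε)
    (r : Fin D → ℂ) (hr : star r ⬝ᵥ r = 1) (Z : Matrix (Fin D) (Fin D) ℂ) (cc z : ℚ) (hz : 0 ≤ z)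
    (hZ₁ : ((((z : ℚ) : ℝ) : ℂ) • (1 : Matrix (Fin D) (Fin D) ℂ) - Z).PosSemidef)
    (hZ₂ : ((((z : ℚ) : ℝ) : ℂ) • (1 : Matrix (Fin D) (Fin D) ℂ) + Z).PosSemidef)
    (hη : (1 + 1 / (1 - ε)) * (ε / (1 - ε)) * (1 + ε) *
      ((4 * (((c - 1) * W + c * (W - 1) : ℕ) : ℝ) + 4 * W + 8 * (c * W)) * (1 + (1 + ε)) + ((z : ℚ) : ℝ)) ≤ η)
    (lab : Fin D → ℤ) (Qc qmin qmax : ℤ)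
    (hBC : ∀ (S : Fin Q) (α β : Fin D), A S α β ≠ 0 → lab β + Qc = lab α + cellCharge κ S)
    (hlab : ∀ α, qmin ≤ lab α ∧ lab α ≤ qmax) (hQc : (8 : ℤ) * Qc = 7 * ((W : ℤ) * (c : ℤ)))
    (hZb : ∀ α β, Z α β ≠ 0 → lab α = lab β)
    {m : ℤ → ℕ} (emb : ∀ q, Fin (m q) → Fin D) (hinj : ∀ q, Function.Injective (emb q))
    (hcover : ∀ α, ∃ i, emb (lab α) i = α)
    (hpsd : ∀ q ∈ Finset.univ.image lab,
      (((((((cc : ℚ) : ℝ) - η : ℝ) : ℂ)) • (1 : Matrix (Fin D) (Fin D) ℂ) -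
          dualMatrix A (stripCellBondMatrix κ hc 1 8) Z).submatrix (emb q) (emb q)).PosSemidef)
    (hbar : cc / ((W : ℚ) * (c : ℚ)) ≤ -18 / 25) :
    Summit.Ventures.CertifiedManyBodySolver.MbsolverRungLeaves.M3Upper_tp0_le_m18o25 := by
  have hγ : stripCellRowBound c W 1 8 = 4 * (((c - 1) * W + c * (W - 1) : ℕ) : ℝ) + 4 * W + 8 * (c * W) := by
    rw [stripCellRowBound_eq]; norm_num
  have hγ0 : (0 : ℝ) ≤ 4 * (((c - 1) * W + c * (W - 1) : ℕ) : ℝ) + 4 * W + 8 * (c * W) := by positivity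
  obtain ⟨hX₁, hX₂⟩ := stripCellBondMatrix_loewner κ hc 1 8 hγ.le
  exact m3Upper_tp0_le_m18o25_of_stripCell_umps_dual_dyadic_sectors W c hW hc κ A hε0 hε1
    hγ0 hG hX₁ hX₂ r hr Z cc z hz hZ₁ hZ₂ hη lab Qc qmin qmax hBC hlab hQc hZb emb hinj hcover hpsd hbar


/-- **CLAIM-NODE PACKAGING** (the shape a `Certificates/…` claim node for a `bd-strip-cell-v1` certificate should take — SPEC §4):
the tensor data existentially packaged in ONE proposition, the scalar side conditions (`0 ≤ ε < 1`, `0 ≤ z`, the slack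
inequality, `8·Qc = 7·W·c`, the bar) left outside as `norm_num` goals of the node file. A node
`@[conjecture] def cert_X : Prop := ∃ A r Z lab m emb, …` with literally this body is consumed by
`m3Upper_tp0_le_m18o25_of_exists_stripCellCert W c hW hc κ D ε η cc z Qc qmin qmax … hc_X`.
HONEST FRAMING: no such certificate exists today; nothing here asserts one. -/
theorem m3Upper_tp0_le_m18o25_of_exists_stripCellCert (W c : ℕ) (hW : 1 ≤ W) (hc : 0 < c)
    (κ : TensorIndex (Fin c ×ₗ Fin W) 4 ≃ Fin Q) (D : ℕ) (ε η : ℝ) (cc z : ℚ) (Qc qmin qmax : ℤ)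
    (hε0 : 0 ≤ ε) (hε1 : ε < 1) (hz : 0 ≤ z)
    (hη : (1 + 1 / (1 - ε)) * (ε / (1 - ε)) * (1 + ε) *
      ((4 * (((c - 1) * W + c * (W - 1) : ℕ) : ℝ) + 4 * W + 8 * (c * W)) * (1 + (1 + ε)) + ((z : ℚ) : ℝ)) ≤ η)
    (hQc : (8 : ℤ) * Qc = 7 * ((W : ℤ) * (c : ℤ))) (hbar : cc / ((W : ℚ) * (c : ℚ)) ≤ -18 / 25)
    (hex : ∃ (A : MPSTensor Q D) (r : Fin D → ℂ) (Z : Matrix (Fin D) (Fin D) ℂ) (lab : Fin D → ℤ)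
        (m : ℤ → ℕ) (emb : ∀ q, Fin (m q) → Fin D),
        (∀ i, ∑ j, ‖(Upper.gram A - 1) i j‖ ≤ ε) ∧ star r ⬝ᵥ r = 1 ∧
        ((((z : ℚ) : ℝ) : ℂ) • (1 : Matrix (Fin D) (Fin D) ℂ) - Z).PosSemidef ∧
        ((((z : ℚ) : ℝ) : ℂ) • (1 : Matrix (Fin D) (Fin D) ℂ) + Z).PosSemidef ∧
        (∀ (S : Fin Q) (α β : Fin D), A S α β ≠ 0 → lab β + Qc = lab α + cellCharge κ S) ∧
        (∀ α, qmin ≤ lab α ∧ lab α ≤ qmax) ∧ (∀ α β, Z α β ≠ 0 → lab α = lab β) ∧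
        (∀ q, Function.Injective (emb q)) ∧ (∀ α, ∃ i, emb (lab α) i = α) ∧
        (∀ q ∈ Finset.univ.image lab,
          (((((((cc : ℚ) : ℝ) - η : ℝ) : ℂ)) • (1 : Matrix (Fin D) (Fin D) ℂ) -
              dualMatrix A (stripCellBondMatrix κ hc 1 8) Z).submatrix (emb q) (emb q)).PosSemidef)) :
    Summit.Ventures.CertifiedManyBodySolver.MbsolverRungLeaves.M3Upper_tp0_le_m18o25 := by
  obtain ⟨A, r, Z, lab, m, emb, hG, hr, hZ₁, hZ₂, hBC, hlab, hZb, hinj, hcover, hpsd⟩ := hex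
  exact m3Upper_tp0_le_m18o25_of_stripCell_umps_dual_dyadic_structural_sectors W c hW hc κ A hε0 hε1 hG r hr Z
    cc z hz hZ₁ hZ₂ hη lab Qc qmin qmax hBC hlab hQc hZb emb hinj hcover hpsd hbar

end Consumers

end Summit.Ventures.CertifiedManyBodySolver.Theorems

end
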